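import Literature.Geometry.Riemannian.ExpMapInjectivity
import Literature.Geometry.Riemannian.CutLocusBishopExp
import Literature.Geometry.Riemannian.CutTimeCutLocus
import Literature.Geometry.Riemannian.RiemVolumeImageEq
import Literature.Geometry.Riemannian.ExpMapGlobalSmooth
import Literature.Geometry.Riemannian.ExpMapHopfRinow
import Mathlib.MeasureTheory.Measure.Lebesgue.EqHaar
import HarnessLib

/-!
# Yau's volume argument by homothety in `T_xM`: the one-centre estimate

Auxiliary file for `RicciNonnegInfiniteVolumeOfBishop.lean` (Calabi–Yau: a complete noncompact
Riemannian manifold with `Ric ≥ 0` has infinite volume; S.-T. Yau, Indiana Univ. Math. J. 25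
(1976) 659–670; Chow et al., *The Ricci flow: techniques and applications I*, AMS 2007, App. A,
Cor. A.6). Here we prove the **one-centre estimate** of Yau's argument, run by homothety in the
tangent space `T_xM = ℝᵐ` (no geodesic polar coordinates, no measure of the cut locus).

Let `(M, g)` be connected with geodesically complete Levi-Civita connection, `d(x, p) = t ≥ 2`,
`q = (t-1)/(t+1)`, and let `J : ℝᵐ → [0, ∞]` be a density dominating the volume of images of
`exp_x` — `Vol(exp_x A) ≤ ∫_A J` for Borel `A ⊆ ℝᵐ`, with equality when `exp_x` is injective on
`A` (the area formula; for the Gram–Jacobian `J = 𝒥` of `exp_x` these are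
`riemVolume_image_le_lintegral_jacobian` / `riemVolume_image_eq_lintegral_jacobian`) — which is
radially non-increasing along minimizing directions (`J w ≤ J (c w)`, `0 < c ≤ 1`, `γ_w|[0,1]`
minimizing: Bishop's comparison theorem in infinitesimal form for `Ric ≥ 0`). Then
(`sum_mul_riemVolume_ball_le`)

  `Vol{d(p,·) < 1} · Σ_{j<n} q^{(j+1) m} ≤ Vol(M)`   for every `n`.

Proof: the shell `S ⊆ T_xM` of minimizing directions `w` with `t - 1 < |w|_g < t + 1` is Borel
(`measurableSet_shell`) and `exp_x(S) ⊇ {d(p,·) < 1}` by Hopf–Rinow and the triangle inequality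
(`ball_subset_image_shell`), so `Vol{d(p,·) < 1} ≤ ∫_S J`. For `0 < c < 1`, `c • S ⊆ ID(x)`
(`smul_mem_injectivityDomain_of_isMinimizingUpTo_one`), on which `exp_x` is injective, so
`Vol(exp_x(c • S)) = ∫_{c S} J = cᵐ ∫_S J(c w) dw ≥ cᵐ ∫_S J ≥ cᵐ Vol{d(p,·) < 1}` (Haar scaling
`setLIntegral_smul_set_eq`). The sets `exp_x(q^{j+1} • S)`, `j < n`, are pairwise disjoint
(`|q^{j+1} w|_g ∈ (q^{j+1}(t-1), q^{j}(t-1))`, injectivity on `ID(x)`) and Borel (Lusin–Souslin),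
and summing gives the estimate.

## References

* S.-T. Yau, *Some function-theoretic properties of complete Riemannian manifold and their
  applications to geometry*, Indiana Univ. Math. J. 25 (1976) 659–670. [Yau1976]
* B. Chow et al., *The Ricci flow: techniques and applications, Part I*, AMS 2007, App. A,
  Cor. A.4 and Cor. A.6. [ChowEtAl2007RicciFlowI]
* J. M. Lee, *Introduction to Riemannian Manifolds*, 2nd ed., Springer 2018, Cor. 6.21,
  Prop. 10.32, p. 310. [LeeRiemannianManifolds2018]
-/

noncomputable section

open Bundle Set Function Filter MeasureTheory Manifold
open scoped Manifold ContDiff Topology ENNReal NNReal Pointwise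

namespace Literature.Geometry.Riemannian

open Lorentzian Lorentzian.PseudoRiemannianMetric

/-! ### Two elementary lemmas: Haar scaling of set integrals on `ℝᵐ`, and Bernoulli -/

section Euclid

/-- **Homothety and the Lebesgue integral on `ℝᵐ`**: for `c > 0`, a set `S ⊆ ℝᵐ` and
`f : ℝᵐ → [0, ∞]`, `∫⁻_{c • S} f = cᵐ ∫⁻_S f (c • w) dw` (the push-forward of Lebesgue measure
under `w ↦ c • w` is `c⁻ᵐ` times Lebesgue measure, `MeasureTheory.Measure.map_addHaar_smul`; no
measurability of `S` or `f` is needed since the homothety is a measurable equivalence).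
[folklore] -/
theorem setLIntegral_smul_set_eq (m : ℕ) {c : ℝ} (hc : 0 < c) (S : Set (EuclideanSpace ℝ (Fin m)))
    (f : EuclideanSpace ℝ (Fin m) → ℝ≥0∞) :
    ∫⁻ u in c • S, f u = ENNReal.ofReal (c ^ m) * ∫⁻ w in S, f (c • w) := by
  have he : MeasurableEmbedding (fun w : EuclideanSpace ℝ (Fin m) ↦ c • w) :=
    measurableEmbedding_const_smul₀ hc.ne'
  have hpre : (fun w : EuclideanSpace ℝ (Fin m) ↦ c • w) ⁻¹' (c • S) = S := by
    ext w
    exact Set.smul_mem_smul_set_iff₀ hc.ne' S w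
  have h1 : ∫⁻ w in S, f (c • w) = ENNReal.ofReal ((c ^ m)⁻¹) * ∫⁻ u in c • S, f u := by
    rw [← hpre, ← he.lintegral_map, ← he.restrict_map, Measure.map_addHaar_smul volume hc.ne',
      Measure.restrict_smul, lintegral_smul_measure, finrank_euclideanSpace_fin, abs_of_nonneg]
    · rw [hpre]
      rfl
    · exact inv_nonneg.2 (pow_nonneg hc.le _)
  rw [h1, ← mul_assoc, ← ENNReal.ofReal_mul (pow_nonneg hc.le _),
    mul_inv_cancel₀ (pow_ne_zero _ hc.ne'), ENNReal.ofReal_one, one_mul]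

/-- **Bernoulli**: for `b ≥ 1` and `4 k ≤ b`, `(1 - 2/b)^k ≥ 1 - 2k/b ≥ 1/2`
(`one_add_mul_le_pow`). [folklore] -/
theorem half_le_pow_of_le {b : ℝ} (hb : 1 ≤ b) {k : ℕ} (hk : 4 * (k : ℝ) ≤ b) :
    (1 / 2 : ℝ) ≤ (1 - 2 / b) ^ k := by
  have hb0 : 0 < b := by linarith
  have hB : -2 ≤ -2 / b := by
    rw [neg_div, neg_le_neg_iff]
    exact div_le_self (by norm_num) hb
  have h1 := one_add_mul_le_pow hB k
  have h2 : (k : ℝ) * (2 / b) ≤ 1 / 2 := by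
    rw [mul_div_assoc', div_le_iff₀ hb0]
    linarith
  calc (1 / 2 : ℝ) ≤ 1 + k * (-2 / b) := by rw [neg_div, mul_neg]; linarith
    _ ≤ (1 + -2 / b) ^ k := h1
    _ = (1 - 2 / b) ^ k := by rw [neg_div, ← sub_eq_add_neg]

end Euclid

/-! ### Shells of minimizing directions in `T_xM` and their images under `exp_x` -/

section Shells

variable {m : ℕ} {M : Type*} [TopologicalSpace M] [T2Space M]
  [ChartedSpace (EuclideanSpace ℝ (Fin m)) M] [IsManifold (𝓡 m) ∞ M]
  [T3Space M] [MeasurableSpace M] [BorelSpace M]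
  {g : PseudoRiemannianMetric (𝓡 m) ∞ (EuclideanSpace ℝ (Fin m)) (TangentSpace (𝓡 m) : M → Type _)}
  [g.HasLeviCivita] [CovariantDerivative.ContMDiffCovariantDerivative g.leviCivita 1]

omit [T2Space M] [T3Space M] [MeasurableSpace M] [BorelSpace M] [g.HasLeviCivita]
  [CovariantDerivative.ContMDiffCovariantDerivative g.leviCivita 1] in
/-- `|c w|_g = c |w|_g` for `c ≥ 0`: `√(g_x(c w, c w)) = c √(g_x(w, w))`. [folklore] -/
theorem sqrt_val_smul_self (x : M) (w : TangentSpace (𝓡 m) x) {c : ℝ} (hc : 0 ≤ c) :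
    Real.sqrt (g.val x (c • w) (c • w)) = c * Real.sqrt (g.val x w w) := by
  have hG : g.val x (c • w) (c • w) = (c * c) * g.val x w w := by
    simp only [map_smul, smul_apply, smul_eq_mul]
    ring
  rw [hG, Real.sqrt_mul (mul_self_nonneg c), Real.sqrt_mul_self hc]

omit [T3Space M] [MeasurableSpace M] [BorelSpace M] in
/-- **Interior rescalings of minimizing directions lie in the injectivity domain** (Lee 2018,
p. 310: `ID(p) = {v : |v| < t_cut}`; here: `γ_w|[0,1]` minimizing and `0 < c < 1` give
`γ_{cw}` minimizing on `[0, 1/c]`, `1/c > 1`, by the rescaling lemma `isMinimizingUpTo_smul_iff`).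
[cite: LeeRiemannianManifolds2018, p. 310] -/
theorem smul_mem_injectivityDomain_of_isMinimizingUpTo_one (hg : g.IsRiemannian)
    (hc : IsGeodesicallyComplete g.leviCivita) {x : M} {w : EuclideanSpace ℝ (Fin m)}
    (hw : IsMinimizingUpTo g hg x w 1) {c : ℝ} (hc0 : 0 < c) (hc1 : c < 1) :
    (c • w : EuclideanSpace ℝ (Fin m)) ∈ injectivityDomain g hg x := by
  haveI : Fact (1 ≤ (∞ : ℕ∞ω)) := ⟨by exact_mod_cast le_top⟩
  have h := (isMinimizingUpTo_smul_iff hg hc x (show TangentSpace (𝓡 m) x from w) hc0 c⁻¹).2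
  rw [mul_inv_cancel₀ hc0.ne'] at h
  exact ⟨c⁻¹, (one_lt_inv₀ hc0).2 hc1, h hw⟩

omit [T3Space M] [MeasurableSpace M] [BorelSpace M] in
/-- **The shell of minimizing directions of `g`-length in `(a, b)` is a Borel subset of
`T_xM = ℝᵐ`**: the set of `w` with `γ_w|[0,1]` minimizing is closed (a slice of
`isClosed_setOf_isMinimizingUpTo`, Lee 2018, proof of Prop. 10.32 (b)) and `w ↦ |w|_g` is
continuous. [cite: LeeRiemannianManifolds2018, Prop. 10.32 (b) (proof)] -/
theorem measurableSet_shell (hg : g.IsRiemannian) (hc : IsGeodesicallyComplete g.leviCivita)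
    (x : M) (a b : ℝ) :
    MeasurableSet {w : EuclideanSpace ℝ (Fin m) | IsMinimizingUpTo g hg x w 1 ∧
      a < Real.sqrt (g.val x w w) ∧ Real.sqrt (g.val x w w) < b} := by
  have h1 : IsClosed {w : EuclideanSpace ℝ (Fin m) | IsMinimizingUpTo g hg x w 1} :=
    (isClosed_setOf_isMinimizingUpTo g le_rfl hg hc x).preimage
      (continuous_id.prodMk continuous_const :
        Continuous fun w : EuclideanSpace ℝ (Fin m) ↦ (w, (1 : ℝ)))
  set G : EuclideanSpace ℝ (Fin m) →L[ℝ] EuclideanSpace ℝ (Fin m) →L[ℝ] ℝ := g.val x with hGdef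
  have hG2 : Continuous fun q : EuclideanSpace ℝ (Fin m) × EuclideanSpace ℝ (Fin m) ↦ G q.1 q.2 :=
    G.continuous₂
  have hN : Continuous fun w : EuclideanSpace ℝ (Fin m) ↦ Real.sqrt (G w w) :=
    Real.continuous_sqrt.comp (hG2.comp (continuous_id.prodMk continuous_id))
  have h2 : IsOpen {w : EuclideanSpace ℝ (Fin m) |
      a < Real.sqrt (G w w) ∧ Real.sqrt (G w w) < b} :=
    isOpen_Ioo.preimage hN
  rw [setOf_and]
  exact h1.measurableSet.inter h2.measurableSet

omit [T3Space M] [MeasurableSpace M] [BorelSpace M] in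
/-- **The unit ball about `p` is swept out by the shell at a far centre `x`** (Hopf–Rinow,
Lee 2018, Cor. 6.21, and the triangle inequality): if `d(x, p) = t` then every `y` with
`d(p, y) < 1` is `exp_x w` for a minimizing direction `w` with `t - 1 < |w|_g = d(x, y) < t + 1`.
[cite: LeeRiemannianManifolds2018, Cor. 6.21] -/
theorem ball_subset_image_shell [ConnectedSpace M] (hg : g.IsRiemannian)
    (hc : IsGeodesicallyComplete g.leviCivita) (x p : M) {t : ℝ} (ht0 : 0 ≤ t)
    (ht : g.edist hg x p = ENNReal.ofReal t) :
    {y : M | g.edist hg p y < 1} ⊆ (fun u : EuclideanSpace ℝ (Fin m) ↦ riemannianExpMap g x u) ''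
      {w : EuclideanSpace ℝ (Fin m) | IsMinimizingUpTo g hg x w 1 ∧
        t - 1 < Real.sqrt (g.val x w w) ∧ Real.sqrt (g.val x w w) < t + 1} := by
  haveI : Fact (1 ≤ (∞ : ℕ∞ω)) := ⟨by exact_mod_cast le_top⟩
  intro y hy
  obtain ⟨w, hw, hwy⟩ := exists_isMinimizingUpTo_of_isGeodesicallyComplete g le_rfl hg hc x y
  have hxy : g.edist hg x y = ENNReal.ofReal (Real.sqrt (g.val x w w)) := by
    rw [← hwy]
    exact edist_eq_of_isMinimizingUpTo hg hc hw
  set d : ℝ := (g.edist hg p y).toReal with hd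
  have hdy : g.edist hg p y = ENNReal.ofReal d :=
    (ENNReal.ofReal_toReal (edist_ne_top hg p y)).symm
  have hd0 : 0 ≤ d := ENNReal.toReal_nonneg
  have hd1 : d < 1 := by
    have h := (ENNReal.toReal_lt_toReal (edist_ne_top hg p y) ENNReal.one_ne_top).2 hy
    rwa [ENNReal.toReal_one] at h
  have hN0 : 0 ≤ Real.sqrt (g.val x w w) := Real.sqrt_nonneg _
  have h1 : Real.sqrt (g.val x w w) ≤ t + d := by
    have h := edist_triangle hg x p y
    rw [hxy, ht, hdy, ← ENNReal.ofReal_add ht0 hd0] at h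
    exact (ENNReal.ofReal_le_ofReal_iff (add_nonneg ht0 hd0)).1 h
  have h2 : t ≤ Real.sqrt (g.val x w w) + d := by
    have h := edist_triangle hg x y p
    rw [hxy, ht, edist_comm hg y p, hdy, ← ENNReal.ofReal_add hN0 hd0] at h
    exact (ENNReal.ofReal_le_ofReal_iff (add_nonneg hN0 hd0)).1 h
  exact ⟨w, ⟨hw, by linarith, by linarith⟩, hwy⟩

/-- **The one-centre estimate of Yau's argument, by homothety in `T_xM`** (Yau 1976; Chow et
al. 2007, App. A, proof of Cor. A.6, with Bishop's comparison Cor. A.4 replaced by its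
infinitesimal form along minimizing directions). Let `d(x, p) = t ≥ 2`, `q = (t-1)/(t+1)`, and
let `J : ℝᵐ → [0, ∞]` dominate the volume of images of `exp_x` (`Vol(exp_x A) ≤ ∫_A J` for Borel
`A`, with equality when `exp_x` is injective on `A`) and be radially non-increasing along
minimizing directions (`J w ≤ J (c w)` for `0 < c ≤ 1`, `γ_w|[0,1]` minimizing). Then
`Vol(M) ≥ Vol{d(p,·) < 1} · Σ_{j<n} q^{(j+1) m}` for every `n`: the shell `S` of minimizing
directions of length in `(t-1, t+1)` covers the unit ball about `p` under `exp_x`, its rescalings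
`q^{j+1} S ⊆ ID(x)` have pairwise disjoint images of volume
`∫_{q^{j+1} S} J = q^{(j+1)m} ∫_S J(q^{j+1} w) dw ≥ q^{(j+1)m} ∫_S J ≥ q^{(j+1)m} Vol{d(p,·) < 1}`.
[cite: Yau1976, Thm. (volume growth), pp. 659–670] -/
theorem sum_mul_riemVolume_ball_le [ConnectedSpace M] (hg : g.IsRiemannian)
    (hc : IsGeodesicallyComplete g.leviCivita) (x p : M) {t : ℝ}
    (ht : g.edist hg x p = ENNReal.ofReal t) (ht2 : 2 ≤ t)
    {J : EuclideanSpace ℝ (Fin m) → ℝ≥0∞}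
    (hle : ∀ A : Set (EuclideanSpace ℝ (Fin m)), MeasurableSet A →
      g.riemVolume ((fun u : EuclideanSpace ℝ (Fin m) ↦ riemannianExpMap g x u) '' A) ≤
        ∫⁻ u in A, J u)
    (heq : ∀ A : Set (EuclideanSpace ℝ (Fin m)), MeasurableSet A →
      InjOn (fun u : EuclideanSpace ℝ (Fin m) ↦ riemannianExpMap g x u) A →
      g.riemVolume ((fun u : EuclideanSpace ℝ (Fin m) ↦ riemannianExpMap g x u) '' A) =
        ∫⁻ u in A, J u)
    (hanti : ∀ w : EuclideanSpace ℝ (Fin m), IsMinimizingUpTo g hg x w 1 →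
      ∀ c : ℝ, 0 < c → c ≤ 1 → J w ≤ J (c • w))
    (n : ℕ) :
    (∑ j ∈ Finset.range n, ENNReal.ofReal (((t - 1) / (t + 1)) ^ ((j + 1) * m))) *
        g.riemVolume {y : M | g.edist hg p y < 1} ≤ g.riemVolume (univ : Set M) := by
  haveI : Fact (1 ≤ (∞ : ℕ∞ω)) := ⟨by exact_mod_cast le_top⟩
  set F : EuclideanSpace ℝ (Fin m) → M := fun u ↦ riemannianExpMap g x u with hFdef
  have hF1 : ContMDiff 𝓘(ℝ, EuclideanSpace ℝ (Fin m)) (𝓡 m) 1 F :=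
    (contMDiff_riemannianExpMap g le_rfl hc x).of_le (WithTop.coe_le_coe.mpr le_top)
  set N : EuclideanSpace ℝ (Fin m) → ℝ := fun w ↦ Real.sqrt (g.val x w w) with hNdef
  set a : ℝ := t - 1 with ha_def
  set b : ℝ := t + 1 with hb_def
  have ha : 0 < a := by rw [ha_def]; linarith
  have hb : 0 < b := by rw [hb_def]; linarith
  have hab : a < b := by rw [ha_def, hb_def]; linarith
  set q : ℝ := a / b with hq_def
  have hq0 : 0 < q := div_pos ha hb
  have hq1 : q < 1 := (div_lt_one hb).2 hab
  have hqb : q * b = a := div_mul_cancel₀ a hb.ne'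
  set S : Set (EuclideanSpace ℝ (Fin m)) :=
    {w | IsMinimizingUpTo g hg x w 1 ∧ a < N w ∧ N w < b} with hS_def
  have hSm : MeasurableSet S := measurableSet_shell hg hc x a b
  -- (a) the unit ball about `p` is covered by `F '' S`
  have hV₁ : g.riemVolume {y : M | g.edist hg p y < 1} ≤ ∫⁻ u in S, J u :=
    (measure_mono (ball_subset_image_shell hg hc x p (by linarith) ht)).trans (hle S hSm)
  -- (b) rescaled shells lie in the injectivity domain, where `exp_x` is injective
  have hID : ∀ c : ℝ, 0 < c → c < 1 → c • S ⊆ injectivityDomain g hg x := by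
    rintro c hc0 hc1 _ ⟨w, hw, rfl⟩
    exact smul_mem_injectivityDomain_of_isMinimizingUpTo_one hg hc hw.1 hc0 hc1
  have hinj : InjOn (riemannianExpMap g x) (injectivityDomain g hg x) :=
    injOn_riemannianExpMap_injectivityDomain g le_rfl hg hc x
  have hinjc : ∀ c : ℝ, 0 < c → c < 1 → InjOn F (c • S) := fun c hc0 hc1 ↦
    hinj.mono (hID c hc0 hc1)
  have hNsmul : ∀ c : ℝ, 0 ≤ c → ∀ w : EuclideanSpace ℝ (Fin m), N (c • w) = c * N w :=
    fun c hc0 w ↦ sqrt_val_smul_self x w hc0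
  have hNmem : ∀ c : ℝ, 0 < c → ∀ u ∈ c • S, c * a < N u ∧ N u < c * b := by
    rintro c hc0 _ ⟨w, hw, rfl⟩
    refine ⟨?_, ?_⟩
    · calc c * a < c * N w := mul_lt_mul_of_pos_left hw.2.1 hc0
        _ = N (c • w) := (hNsmul c hc0.le w).symm
    · calc N (c • w) = c * N w := hNsmul c hc0.le w
        _ < c * b := mul_lt_mul_of_pos_left hw.2.2 hc0
  -- the volume of the image of one rescaled shell
  have hlow : ∀ c : ℝ, 0 < c → c < 1 →
      ENNReal.ofReal (c ^ m) * g.riemVolume {y : M | g.edist hg p y < 1} ≤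
        g.riemVolume (F '' (c • S)) := by
    intro c hc0 hc1
    rw [heq (c • S) (hSm.const_smul_of_ne_zero hc0.ne') (hinjc c hc0 hc1),
      setLIntegral_smul_set_eq m hc0 S J]
    gcongr ENNReal.ofReal (c ^ m) * ?_
    exact hV₁.trans (setLIntegral_mono' hSm fun w hw ↦ hanti w hw.1 c hc0 hc1.le)
  -- (c) the disjoint family `F '' (q^(j+1) • S)`, `j < n`
  have hcj0 : ∀ j : ℕ, 0 < q ^ (j + 1) := fun j ↦ pow_pos hq0 _
  have hcj1 : ∀ j : ℕ, q ^ (j + 1) < 1 := fun j ↦ pow_lt_one₀ hq0.le hq1 (Nat.succ_ne_zero j)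
  have hAm : ∀ j : ℕ, MeasurableSet (F '' (q ^ (j + 1) • S)) := fun j ↦
    measurableSet_image_of_contMDiff_injOn hF1 (hSm.const_smul_of_ne_zero (hcj0 j).ne')
      (hinjc _ (hcj0 j) (hcj1 j))
  have hdisj : ∀ i j : ℕ, i < j →
      Disjoint (F '' (q ^ (i + 1) • S)) (F '' (q ^ (j + 1) • S)) := by
    intro i j hij
    refine disjoint_image_image fun u hu u' hu' huu' ↦ ?_
    have he : u = u' :=
      hinj (hID _ (hcj0 i) (hcj1 i) hu) (hID _ (hcj0 j) (hcj1 j) hu') huu'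
    subst he
    have h1 := (hNmem _ (hcj0 i) u hu).1
    have h2 := (hNmem _ (hcj0 j) u hu').2
    have h3 : q ^ (j + 1) * b ≤ q ^ (i + 1) * a := by
      rw [pow_succ, mul_assoc, hqb]
      exact mul_le_mul_of_nonneg_right
        (pow_le_pow_of_le_one hq0.le hq1.le (Nat.succ_le_of_lt hij)) ha.le
    exact lt_irrefl _ (h1.trans (h2.trans_le h3))
  have hPD : (↑(Finset.range n) : Set ℕ).PairwiseDisjoint fun j ↦ F '' (q ^ (j + 1) • S) := by
    intro i _ j _ hij
    rcases Nat.lt_or_gt_of_ne hij with h | h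
    · exact hdisj i j h
    · exact (hdisj j i h).symm
  -- summing up
  calc (∑ j ∈ Finset.range n, ENNReal.ofReal (q ^ ((j + 1) * m))) *
          g.riemVolume {y : M | g.edist hg p y < 1}
      = ∑ j ∈ Finset.range n, ENNReal.ofReal ((q ^ (j + 1)) ^ m) *
          g.riemVolume {y : M | g.edist hg p y < 1} := by
        rw [Finset.sum_mul]
        refine Finset.sum_congr rfl fun j _ ↦ ?_
        rw [← pow_mul]
    _ ≤ ∑ j ∈ Finset.range n, g.riemVolume (F '' (q ^ (j + 1) • S)) :=
        Finset.sum_le_sum fun j _ ↦ hlow _ (hcj0 j) (hcj1 j)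
    _ = g.riemVolume (⋃ j ∈ Finset.range n, F '' (q ^ (j + 1) • S)) :=
        (measure_biUnion_finset hPD fun j _ ↦ hAm j).symm
    _ ≤ g.riemVolume (univ : Set M) := measure_mono (subset_univ _)

end Shells

end Literature.Geometry.Riemannian

end
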